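import Summits.MatrixMultiplication.MatrixMultiplication.Theses.TropicalBiniPatterns
import Literature.Computability.AlgebraicComplexity.CoppersmithWinograd1982Improvable

/-!
# BC2-redirect census probes for `TropicalBiniPatterns.BorderCertificateFamily` (stmt-MatrixMultiplication-8005)

Scratch file of the crux-strategist seat (folder `bc/Census.lean`), sorry-free.  It records, as
kernel-checked theorems, the cheap implications that DISQUALIFY candidate pieces of a typed
decomposition `X₁ ∧ … ∧ X_k → BorderCertificateFamily` under rule (c) ("no piece equivalent to the
crux or to the Statement"), and the equivalence `BorderCertificateFamily ↔ MatrixMultiplication`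
itself (both directions provable-now glue over tree theorems).
-/

open Literature.Computability.AlgebraicComplexity
open scoped BigOperators

namespace Summit.MatrixMultiplication.MatrixMultiplication.Cruxes.BorderCertificateFamily.Census

open Summit.MatrixMultiplication.MatrixMultiplication.Theses.TropicalBiniPatterns

/-! ## 0. The crux is the Statement: `BorderCertificateFamily ↔ ω(ℂ) = 2` -/

/-- Volume bookkeeping: `((N·N·N : ℕ) : ℝ) ^ (θ/3) = N ^ θ`. -/
theorem cast_cube_rpow_div_three (N : ℕ) (θ : ℝ) :
    ((N * N * N : ℕ) : ℝ) ^ (θ / 3) = (N : ℝ) ^ θ := by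
  have hN : (0 : ℝ) ≤ N := Nat.cast_nonneg N
  rw [show ((N * N * N : ℕ) : ℝ) = ((N : ℝ) ^ (3 : ℝ)) by
    rw [show (3 : ℝ) = ((3 : ℕ) : ℝ) by norm_num, Real.rpow_natCast]; push_cast; ring]
  rw [← Real.rpow_mul hN]
  congr 1
  ring

/-- The converse of the route's deciding theorem: `ω(ℂ) = 2 → BorderCertificateFamily`, with
`p = 1`, the single block `⟨N,N,N⟩` and `r = R(⟨N,N,N⟩) < N^{2+ε}`
(`exists_tensorRank_matMulTensor_lt_rpow`, the definition of `ω` as an infimum). -/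
theorem borderCertificateFamily_of_statement (hS : _root_.MatrixMultiplication) :
    BorderCertificateFamily := by
  intro ε hε
  have hω : omega ℂ = 2 := hS
  obtain ⟨N, hN, hR⟩ :=
    exists_tensorRank_matMulTensor_lt_rpow ℂ (θ := 2 + ε) (by rw [hω]; linarith)
  refine ⟨1, fun _ => N, fun _ => N, fun _ => N, tensorRank (matMulTensor ℂ N N N), Nat.one_pos,
    fun _ => ?_, algBorderRank_matMulDirectSum_one_block_le_tensorRank ℂ N, ?_⟩
  · calc 2 ≤ N := hN
      _ = N * 1 * 1 := by ring
      _ ≤ N * N * N := by gcongr <;> omega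
  · rw [Fin.sum_univ_one, show (2 + ε) / 3 = (2 + ε) / 3 from rfl, cast_cube_rpow_div_three]
    exact hR.le

/-- Hence the crux is EQUIVALENT to the summit statement, both directions being short glue over
tree theorems (`closes` is the route's deciding theorem). -/
theorem borderCertificateFamily_iff_statement : BorderCertificateFamily ↔ _root_.MatrixMultiplication :=
  ⟨closes, borderCertificateFamily_of_statement⟩

/-! ## D7. Regime split in `ε`: the small-`ε` piece alone is the crux (monotonicity in `ε`) -/

/-- Candidate piece: certificates only for `ε < ε₀`. -/
def SmallEpsFamily (ε₀ : ℝ) : Prop :=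
  ∀ ε : ℝ, 0 < ε → ε < ε₀ → ∃ (p : ℕ) (k m n : Fin p → ℕ) (r : ℕ), 0 < p ∧
    (∀ i, 2 ≤ k i * m i * n i) ∧ algBorderRank (matMulDirectSum ℂ k m n) ≤ r ∧
    (r : ℝ) ≤ ∑ i, ((k i * m i * n i : ℕ) : ℝ) ^ ((2 + ε) / 3)

/-- Candidate piece: certificates only for `ε ≥ ε₀`. -/
def LargeEpsFamily (ε₀ : ℝ) : Prop :=
  ∀ ε : ℝ, ε₀ ≤ ε → ∃ (p : ℕ) (k m n : Fin p → ℕ) (r : ℕ), 0 < p ∧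
    (∀ i, 2 ≤ k i * m i * n i) ∧ algBorderRank (matMulDirectSum ℂ k m n) ≤ r ∧
    (r : ℝ) ≤ ∑ i, ((k i * m i * n i : ℕ) : ℝ) ^ ((2 + ε) / 3)

/-- (c)-violation: the small-`ε` piece ALONE gives the crux (a certificate for `ε' = min(ε, ε₀/2)`
serves every larger `ε`, as `x ↦ v^x` is monotone for `v ≥ 2`). -/
theorem borderCertificateFamily_of_smallEps {ε₀ : ℝ} (hε₀ : 0 < ε₀) (h : SmallEpsFamily ε₀) :
    BorderCertificateFamily := by
  intro ε hε
  obtain ⟨p, k, m, n, r, hp, hkmn, hR, hr⟩ :=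
    h (min ε (ε₀ / 2)) (lt_min hε (by linarith)) (min_lt_of_right_lt (by linarith))
  refine ⟨p, k, m, n, r, hp, hkmn, hR, hr.trans (Finset.sum_le_sum fun i _ => ?_)⟩
  exact Real.rpow_le_rpow_of_exponent_le
    (by exact_mod_cast (le_trans (by norm_num) (hkmn i) : 1 ≤ k i * m i * n i))
    (by gcongr; exact min_le_left _ _)

/-- … and the large-`ε` piece is a THEOREM for `ε₀ = 1` (the trivial certificate `⟨2,1,1⟩`,
`r = 2 = 2^{(2+ε)/3·…}`… precisely `R(⟨2,1,1⟩) ≤ 2 ≤ 2^{(2+ε)/3}` for `ε ≥ 1`), so it is not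
load-bearing: (a)-violation. -/
theorem largeEpsFamily_one : LargeEpsFamily 1 := by
  intro ε hε
  refine ⟨1, fun _ => 2, fun _ => 1, fun _ => 1, 2, Nat.one_pos, fun _ => by norm_num, ?_, ?_⟩
  · calc algBorderRank (matMulDirectSum ℂ (fun _ : Fin 1 => 2) (fun _ => 1) (fun _ => 1))
        ≤ tensorRank (matMulDirectSum ℂ (fun _ : Fin 1 => 2) (fun _ => 1) (fun _ => 1)) :=
          algBorderRank_le_tensorRank _
      _ = tensorRank (matMulTensor ℂ 2 1 1) := tensorRank_matMulDirectSum_one_block ℂ 2 1 1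
      _ ≤ 2 * 1 * 1 := tensorRank_matMulTensor_le ℂ 2 1 1
      _ = 2 := by norm_num
  · rw [Fin.sum_univ_one]
    have h1 : (1 : ℝ) ≤ (2 + ε) / 3 := by linarith
    calc ((2 : ℕ) : ℝ) = (2 : ℝ) ^ (1 : ℝ) := by norm_num
      _ ≤ (2 : ℝ) ^ ((2 + ε) / 3) := Real.rpow_le_rpow_of_exponent_le (by norm_num) h1
      _ = ((2 * 1 * 1 : ℕ) : ℝ) ^ ((2 + ε) / 3) := by norm_num

/-! ## D11. Exact-vs-border split: the exact-certificate family alone is the Statement -/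

/-- Candidate piece: the same certificate family for the RANK (exact algorithms). -/
def ExactCertificateFamily : Prop :=
  ∀ ε : ℝ, 0 < ε → ∃ (p : ℕ) (k m n : Fin p → ℕ) (r : ℕ), 0 < p ∧ (∀ i, 2 ≤ k i * m i * n i) ∧
    tensorRank (matMulDirectSum ℂ k m n) ≤ r ∧
    (r : ℝ) ≤ ∑ i, ((k i * m i * n i : ℕ) : ℝ) ^ ((2 + ε) / 3)

/-- (c)-violation, first half: exact certificates are border certificates (`bR ≤ R`). -/
theorem borderCertificateFamily_of_exact (h : ExactCertificateFamily) : BorderCertificateFamily := by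
  intro ε hε
  obtain ⟨p, k, m, n, r, hp, hkmn, hR, hr⟩ := h ε hε
  exact ⟨p, k, m, n, r, hp, hkmn, (algBorderRank_le_tensorRank _).trans hR, hr⟩

/-- (c)-violation, second half: the Statement gives exact certificates (`ω` is DEFINED through the
rank), so `ExactCertificateFamily ↔ MatrixMultiplication ↔ BorderCertificateFamily`. -/
theorem exactCertificateFamily_of_statement (hS : _root_.MatrixMultiplication) : ExactCertificateFamily := by
  intro ε hε
  have hω : omega ℂ = 2 := hS
  obtain ⟨N, hN, hR⟩ :=
    exists_tensorRank_matMulTensor_lt_rpow ℂ (θ := 2 + ε) (by rw [hω]; linarith)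
  refine ⟨1, fun _ => N, fun _ => N, fun _ => N, tensorRank (matMulTensor ℂ N N N), Nat.one_pos,
    fun _ => ?_, (tensorRank_matMulDirectSum_one_block ℂ N N N).le, ?_⟩
  · calc 2 ≤ N := hN
      _ = N * 1 * 1 := by ring
      _ ≤ N * N * N := by gcongr <;> omega
  · rw [Fin.sum_univ_one, cast_cube_rpow_div_three]
    exact hR.le

theorem exactCertificateFamily_iff_statement : ExactCertificateFamily ↔ _root_.MatrixMultiplication :=
  ⟨fun h => closes (borderCertificateFamily_of_exact h), exactCertificateFamily_of_statement⟩

/-! ## D8. Amortised fixed block: alone implies the Statement (and is refuted by Koszul flattenings) -/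

/-- Candidate piece: the amortised border rank of `p` disjoint copies of a FIXED `⟨n,n,n⟩` tends to
the flattening value `n²`. -/
def AmortisedBlock (n : ℕ) : Prop :=
  ∀ δ : ℝ, 0 < δ → ∃ p : ℕ, 0 < p ∧
    (algBorderRank (matMulDirectSum ℂ (fun _ : Fin p => n) (fun _ => n) (fun _ => n)) : ℝ) ≤
      ((n : ℝ) ^ (2 : ℝ) + δ) * p

/-- (c)-violation: `AmortisedBlock n` (`n ≥ 2`) ALONE gives `ω(ℂ) = 2`, by the proved border-rank
asymptotic sum inequality: `p · n^ω ≤ bR(p ⊙ ⟨n,n,n⟩) ≤ (n² + δ) p` for all `δ > 0`. -/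
theorem statement_of_amortisedBlock {n : ℕ} (hn : 2 ≤ n) (h : AmortisedBlock n) :
    _root_.MatrixMultiplication := by
  show omega ℂ = 2
  refine le_antisymm ?_ (omega_two_le ℂ)
  have hn' : (1 : ℝ) < n := by exact_mod_cast hn
  -- `n^ω ≤ n² + δ` for every `δ > 0`
  have key : ∀ δ : ℝ, 0 < δ → (n : ℝ) ^ omega ℂ ≤ (n : ℝ) ^ (2 : ℝ) + δ := by
    intro δ hδ
    obtain ⟨p, hp, hb⟩ := h δ hδ
    have hASI := asymptoticSumInequality_algBorderRank ℂ (fun _ : Fin p => n) (fun _ => n)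
      (fun _ => n) le_rfl
    rw [Finset.sum_const, Finset.card_univ, Fintype.card_fin, nsmul_eq_mul,
      cast_cube_rpow_div_three] at hASI
    have hp' : (0 : ℝ) < p := by exact_mod_cast hp
    have := hASI.trans hb
    rw [mul_comm] at this
    exact le_of_mul_le_mul_right this hp'
  have hle : (n : ℝ) ^ omega ℂ ≤ (n : ℝ) ^ (2 : ℝ) := le_of_forall_pos_le_add key
  exact (Real.rpow_le_rpow_left_iff hn').1 hle

/-! ## D6. Iteration split (seed + unstructured improvement step): the step alone is the Statement -/

/-- Candidate piece: every certificate with exponent `τ > 2/3` can be bettered to exponent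
`(τ + 2/3)/2` (a uniform, but UNSTRUCTURED, improvement step). -/
def ImprovementStep : Prop :=
  ∀ (p : ℕ) (k m n : Fin p → ℕ) (r : ℕ) (τ : ℝ), 0 < p → (∀ i, 2 ≤ k i * m i * n i) →
    algBorderRank (matMulDirectSum ℂ k m n) ≤ r →
    (r : ℝ) ≤ ∑ i, ((k i * m i * n i : ℕ) : ℝ) ^ τ → 2 / 3 < τ →
    ∃ (p' : ℕ) (k' m' n' : Fin p' → ℕ) (r' : ℕ), 0 < p' ∧ (∀ i, 2 ≤ k' i * m' i * n' i) ∧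
      algBorderRank (matMulDirectSum ℂ k' m' n') ≤ r' ∧
      (r' : ℝ) ≤ ∑ i, ((k' i * m' i * n' i : ℕ) : ℝ) ^ ((τ + 2 / 3) / 2)

/-- (c)-violation, first half: the Statement gives the step outright (the output ignores the input:
it is the `BorderCertificateFamily` certificate at `ε = (3τ - 2)/2`). -/
theorem improvementStep_of_statement (hS : _root_.MatrixMultiplication) : ImprovementStep := by
  intro p k m n r τ _ _ _ _ hτ
  obtain ⟨p', k', m', n', r', hp', hkmn', hR', hr'⟩ :=
    borderCertificateFamily_of_statement hS ((3 * τ - 2) / 2) (by linarith)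
  refine ⟨p', k', m', n', r', hp', hkmn', hR', ?_⟩
  rw [show (τ + 2 / 3) / 2 = (2 + (3 * τ - 2) / 2) / 3 by ring]
  exact hr'

/-- The trivial seed: `⟨2,1,1⟩` with `r = 2` is a certificate of exponent `τ = 1`. -/
theorem seed_certificate :
    ∃ (p : ℕ) (k m n : Fin p → ℕ) (r : ℕ), 0 < p ∧ (∀ i, 2 ≤ k i * m i * n i) ∧
      algBorderRank (matMulDirectSum ℂ k m n) ≤ r ∧
      (r : ℝ) ≤ ∑ i, ((k i * m i * n i : ℕ) : ℝ) ^ (1 : ℝ) := by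
  refine ⟨1, fun _ => 2, fun _ => 1, fun _ => 1, 2, Nat.one_pos, fun _ => by norm_num, ?_, ?_⟩
  · calc algBorderRank (matMulDirectSum ℂ (fun _ : Fin 1 => 2) (fun _ => 1) (fun _ => 1))
        ≤ tensorRank (matMulDirectSum ℂ (fun _ : Fin 1 => 2) (fun _ => 1) (fun _ => 1)) :=
          algBorderRank_le_tensorRank _
      _ = tensorRank (matMulTensor ℂ 2 1 1) := tensorRank_matMulDirectSum_one_block ℂ 2 1 1
      _ ≤ 2 * 1 * 1 := tensorRank_matMulTensor_le ℂ 2 1 1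
      _ = 2 := by norm_num
  · simp

/-- (c)-violation, second half: the step ALONE gives the crux, by iterating it from the trivial
seed (`τ_j = 2/3 + 3^{-1}·2^{-j} ↓ 2/3`). Hence `ImprovementStep ↔ MatrixMultiplication`. -/
theorem borderCertificateFamily_of_improvementStep (h : ImprovementStep) :
    BorderCertificateFamily := by
  -- certificates of exponent `τ_j := 2/3 + (1/3) / 2^j` for every `j`
  have iter : ∀ j : ℕ, ∃ (p : ℕ) (k m n : Fin p → ℕ) (r : ℕ), 0 < p ∧ (∀ i, 2 ≤ k i * m i * n i) ∧
      algBorderRank (matMulDirectSum ℂ k m n) ≤ r ∧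
      (r : ℝ) ≤ ∑ i, ((k i * m i * n i : ℕ) : ℝ) ^ (2 / 3 + (1 / 3) / (2 : ℝ) ^ j) := by
    intro j
    induction j with
    | zero =>
      obtain ⟨p, k, m, n, r, hp, hkmn, hR, hr⟩ := seed_certificate
      exact ⟨p, k, m, n, r, hp, hkmn, hR, by norm_num at hr ⊢; exact hr⟩
    | succ j ih =>
      obtain ⟨p, k, m, n, r, hp, hkmn, hR, hr⟩ := ih
      have hτ : (2 : ℝ) / 3 < 2 / 3 + 1 / 3 / (2 : ℝ) ^ j := by
        have : (0 : ℝ) < 1 / 3 / (2 : ℝ) ^ j := by positivity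
        linarith
      obtain ⟨p', k', m', n', r', hp', hkmn', hR', hr'⟩ := h p k m n r _ hp hkmn hR hr hτ
      refine ⟨p', k', m', n', r', hp', hkmn', hR', ?_⟩
      rw [show (2 / 3 + 1 / 3 / (2 : ℝ) ^ (j + 1)) = (2 / 3 + 1 / 3 / (2 : ℝ) ^ j + 2 / 3) / 2 by
        rw [pow_succ]; field_simp; ring]
      exact hr'
  intro ε hε
  -- choose `j` with `(1/3)/2^j ≤ ε/3`, i.e. `τ_j ≤ (2+ε)/3`
  obtain ⟨j, hj⟩ : ∃ j : ℕ, (1 / 3) / (2 : ℝ) ^ j ≤ ε / 3 := by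
    obtain ⟨j, hj⟩ := exists_pow_lt_of_lt_one (show 0 < ε by exact hε) (show (1 / 2 : ℝ) < 1 by norm_num)
    refine ⟨j, ?_⟩
    rw [one_div_pow] at hj
    have : 1 / (2 : ℝ) ^ j ≤ ε := hj.le
    calc (1 / 3) / (2 : ℝ) ^ j = (1 / 3) * (1 / (2 : ℝ) ^ j) := by ring
      _ ≤ (1 / 3) * ε := by gcongr
      _ = ε / 3 := by ring
  obtain ⟨p, k, m, n, r, hp, hkmn, hR, hr⟩ := iter j
  refine ⟨p, k, m, n, r, hp, hkmn, hR, hr.trans (Finset.sum_le_sum fun i _ => ?_)⟩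
  exact Real.rpow_le_rpow_of_exponent_le
    (by exact_mod_cast (le_trans (by norm_num) (hkmn i) : 1 ≤ k i * m i * n i))
    (by linarith)

theorem improvementStep_iff_statement : ImprovementStep ↔ _root_.MatrixMultiplication :=
  ⟨fun h => closes (borderCertificateFamily_of_improvementStep h), improvementStep_of_statement⟩

end Summit.MatrixMultiplication.MatrixMultiplication.Cruxes.BorderCertificateFamily.Census
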